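import Literature.AlgebraicGeometry.Resolution.QuadraticTransformsProofs
import Literature.AlgebraicGeometry.Resolution.QuadraticSequencePrincipalGenerator
import HarnessLib

/-!
# Along ANY infinite sequence of quadratic transforms of a two-dimensional regular local ring, every finitely
# generated ideal becomes principal (Zariski; Abhyankar 1956, Lemma 12 ⇒ Lipman 1969, proof of Theorem (26.2))

Topic: `Literature/AlgebraicGeometry/Resolution`. PROVED, fact-free, definition-free (hand
leafhand-res-homologicalconduct-16 g2 of the cell decomp-res; AI-written, weaker than expert review).

Lipman 1969, proof of Theorem (26.2), p. 274: «There results an infinite sequence of two-dimensional local rings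
`R₁ < R₂ < R₃ < …` with field of fractions `K` such that (i): the maximal ideal of each `R_i` is contained in a proper
principal ideal of `R_{i+1}`, and such that (ii): all the `R_i` are dominated by a single … valuation `v` … (i)
implies that the valuation ring `R_v` must be equal to `⋃ R_i`.»  The tree has the last sentence in full generality
as Abhyankar's union lemma `AbhyankarQuadraticUnion_holds` (`QuadraticTransformsProofs.lean`: along the sequence of
quadratic transforms of a two-dimensional regular local ring `R 0` of `K` along ANY valuation ring `O` dominating it,
`O = ⋃ R i`), and the termination engine `exists_principal_generator_of_chain`
(`QuadraticSequencePrincipalGenerator.lean`).  Together (this file):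

* `exists_principal_generator_of_quadraticSequenceAlong` — **for every valuation ring `O` of `K` dominating the
  two-dimensional regular local ring `R 0` (`Frac (R 0) = K`) and the sequence `R 0 → R 1 → ⋯` of quadratic
  transforms along `O`, every finite `T ⊆ R 0` with a non-zero member generates, in some `R n`, the PRINCIPAL
  ideal `a · R n` of one of its members `a ∈ T`** — no Noetherian dominating ring is needed (contrast
  `exists_principal_generator_of_quadraticSequence`, Huneke–Swanson's setting).

Use: the termination half of Zariski's Theorem (26.1)/(26.2) for the principalization of ideal sheaves on regular
surfaces (tree `PrincipalizationFromNoInfiniteRun.lean`, hypothesis «no infinite run»; `Lipman1969_1_2_B_of_principalization_finite`):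
an infinite run of blow-ups at bad closed points contains an infinite thread of infinitely-near bad points, whose
local rings are the quadratic sequence along a valuation ring dominating their union (Chevalley, Mathlib
`LocalSubring.exists_le_valuationSubring`); this file makes the ideal principal at some stage of the thread —
contradiction.  The thread extraction and the scheme ↔ ring dictionary (`BlowupStalkQuadraticTransform.lean`) are NOT
here.  No summit statement is proved.

## References
* J. Lipman, Publ. Math. IHÉS 36 (1969), Theorem (26.2) and its proof (p. 274). [Lipman1969]
* S. S. Abhyankar, Amer. J. Math. 78 (1956), Lemma 12; S. D. Cutkosky, Math. Ann. 362 (2015), Lemma 2.2.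
  [Abhyankar1956Valuations] [Cutkosky2014]
-/

noncomputable section

namespace Literature.AlgebraicGeometry.Resolution

universe u

open IsLocalRing

variable {K : Type u} [Field K]

/-- **Zariski's termination along a valuation** (Lipman 1969, proof of (26.2); Abhyankar's union lemma + the
divisibility engine): along the sequence of quadratic transforms of a two-dimensional regular local ring `R 0` of `K`
along a valuation ring `O` dominating it, every finite set `T ⊆ R 0` with a non-zero member generates a PRINCIPAL
ideal `a · R n`, `a ∈ T`, `a ≠ 0`, for some `n` (and all of `T` lies in that `R n`).
[cite: Lipman1969, Theorem (26.2), proof (p. 274)] [cite: Abhyankar1956Valuations, Lemma 12]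
[cite: Cutkosky2014, Lemma 2.2] -/
theorem exists_principal_generator_of_quadraticSequenceAlong (O : ValuationSubring K) (R : ℕ → Subring K)
    (hreg : IsRegularLocalRing (R 0)) (hdim : ringKrullDim (R 0) = 2) (hof : IsLocalRingOf (R 0))
    (hdom : SubringDominates (R 0) O.toSubring)
    (hqt : ∀ i, IsQuadraticTransformAlong O (R i) (R (i + 1)))
    (T : Finset K) (hT : ∀ t ∈ T, t ∈ R 0) (hne : ∃ t ∈ T, t ≠ 0) :
    ∃ n, ∃ a ∈ T, a ≠ 0 ∧ (∀ t ∈ T, t ∈ R n) ∧ ∀ t ∈ T, ∃ r ∈ R n, t = a * r := by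
  have hmono : ∀ n, R n ≤ R (n + 1) := fun n => (hqt n).le
  have hRmono : Monotone R := monotone_nat_of_le_succ hmono
  -- Abhyankar: `O = ⋃ R i`
  have hunion : ∀ z : K, z ∈ O ↔ ∃ i, z ∈ R i :=
    AbhyankarQuadraticUnion_holds K O R hreg hdim hof hdom hqt
  -- hence the chain exhausts `K` up to inversion
  have hval : ∀ z : K, (∃ n, z ∈ R n) ∨ (∃ n, z⁻¹ ∈ R n) := fun z => by
    rcases O.mem_or_inv_mem z with hz | hz
    · exact Or.inl ((hunion z).mp hz)
    · exact Or.inr ((hunion z⁻¹).mp hz)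
  obtain ⟨n, a, haT, ha0, h⟩ := exists_principal_generator_of_chain R hmono hval T hne
  exact ⟨n, a, haT, ha0, fun t ht => hRmono (Nat.zero_le n) (hT t ht), h⟩

/-- **Ideal form.** With the same data, for the ideal `I` of `R 0` spanned by a finite set `T` with a non-zero
member, the extended ideal `I · R n` is the principal ideal of (the image of) some `a ∈ T` for some `n`:
`I.map (R 0 → R n) = span {a}`. [cite: Lipman1969, Theorem (26.2), proof (p. 274)] [cite: Abhyankar1956Valuations, Lemma 12] -/
theorem exists_map_span_eq_span_singleton_of_quadraticSequenceAlong (O : ValuationSubring K)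
    (R : ℕ → Subring K) (hreg : IsRegularLocalRing (R 0)) (hdim : ringKrullDim (R 0) = 2)
    (hof : IsLocalRingOf (R 0)) (hdom : SubringDominates (R 0) O.toSubring)
    (hqt : ∀ i, IsQuadraticTransformAlong O (R i) (R (i + 1)))
    (T : Finset (R 0)) (hne : ∃ t ∈ T, t ≠ 0) :
    ∃ (n : ℕ) (hle : R 0 ≤ R n) (a : R 0), a ∈ T ∧ a ≠ 0 ∧
      (Ideal.span (T : Set (R 0))).map (Subring.inclusion hle) =
        Ideal.span {Subring.inclusion hle a} := by
  classical
  have hmono : ∀ n, R n ≤ R (n + 1) := fun n => (hqt n).le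
  have hRmono : Monotone R := monotone_nat_of_le_succ hmono
  -- the generators read in `K`
  set T' : Finset K := T.image (fun t : R 0 => (t : K)) with hT'
  have hT'mem : ∀ t ∈ T', t ∈ R 0 := by
    intro t ht
    obtain ⟨s, -, rfl⟩ := Finset.mem_image.mp ht
    exact s.2
  have hne' : ∃ t ∈ T', t ≠ 0 := by
    obtain ⟨t, ht, ht0⟩ := hne
    exact ⟨(t : K), Finset.mem_image.mpr ⟨t, ht, rfl⟩, fun h => ht0 (Subtype.ext h)⟩
  obtain ⟨n, a, haT', ha0, -, hgen⟩ :=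
    exists_principal_generator_of_quadraticSequenceAlong O R hreg hdim hof hdom hqt T' hT'mem hne'
  obtain ⟨a₀, ha₀T, rfl⟩ := Finset.mem_image.mp haT'
  have hle : R 0 ≤ R n := hRmono (Nat.zero_le n)
  refine ⟨n, hle, a₀, ha₀T, fun h => ha0 (by rw [h]; rfl), ?_⟩
  apply le_antisymm
  · -- every generator is a multiple of `a₀` in `R n`
    rw [Ideal.map_span, Ideal.span_le]
    rintro _ ⟨t, ht, rfl⟩
    obtain ⟨r, hr, htr⟩ := hgen (t : K) (Finset.mem_image.mpr ⟨t, ht, rfl⟩)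
    rw [SetLike.mem_coe, Ideal.mem_span_singleton']
    refine ⟨⟨r, hr⟩, Subtype.ext ?_⟩
    change r * ((a₀ : R 0) : K) = ((t : R 0) : K)
    rw [htr, mul_comm]
  · -- `a₀` is one of the generators
    rw [Ideal.span_singleton_le_iff_mem, Ideal.map_span]
    exact Ideal.subset_span ⟨a₀, ha₀T, rfl⟩

end Literature.AlgebraicGeometry.Resolution

end
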